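import Literature.NumberTheory.EllipticCurves.PAdicHeightsLogProofs

/-!
# BirchSwinnertonDyer / PAdicOrderV2 — crux `PAdicOrderThesisR2` (stmt-0487), line `wieferich-jet`,
# stub `stub_jetVisible_of_not_heightWieferich`: not height-Wieferich ⇒ jet visible

Registered stub V of the `wieferich-jet` skeleton (`Cruxes/PAdicOrderThesisR2/Lines/wieferich_jet.lean`),
the curve-free "visibility" half of the jet certificate: for an odd prime `p` and `x ∈ ℚ` whose
numerator `a = num x` is a `p`-unit, if `a^{p-1} ≢ 1 (mod p^{v_p(den x)})` (and `a^{p-1} ≠ 1`), then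
`p^{-v_p(den x)} < ‖log_p a‖_p` for the Iwasawa logarithm `log_p`
(`Literature.NumberTheory.EllipticCurves.padicLog`).

Proof (Iwasawa 1972, §4.4; everything used is proved in the tree / Mathlib): for a `p`-unit
integer `a`, `ord_p a = 0`, so `log_p a = (p-1)⁻¹ · L(a^{p-1})` (`padicLog_of_ne_zero`);
`‖p - 1‖_p = 1`; `a^{p-1}` is a principal unit (`norm_one_sub_pow_sub_one_lt`, Fermat) and for
`p ≠ 2` one has `‖2‖_p = 1`, so the isometry of the logarithm near `1` (`norm_padicLogSeries_eq`)
gives `‖L(a^{p-1})‖_p = ‖1 - a^{p-1}‖_p = ‖a^{p-1} - 1‖_p = p^{-v_p(a^{p-1} - 1)}` for the non-zero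
integer `a^{p-1} - 1`; finally `v_p(a^{p-1} - 1) < v_p(den x)` is the hypothesis.
-/

-- single-conjunct summit: `Summit.BirchSwinnertonDyer.BirchSwinnertonDyer.…` repeats the name by design
set_option linter.dupNamespace false

namespace Summit.BirchSwinnertonDyer.BirchSwinnertonDyer.Cruxes.PAdicOrderThesisR2.WieferichJet

open Literature.NumberTheory.EllipticCurves

/-- **The Iwasawa logarithm is an isometry on `p`-unit integers, `p` odd**: for `p ≠ 2` and an
integer `a` with `p ∤ a`, `‖log_p a‖_p = ‖a^{p-1} - 1‖_p`. Indeed `ord_p a = 0`, so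
`log_p a = (p-1)⁻¹ · L(a^{p-1})` with `‖p-1‖_p = 1`, and `‖L(y)‖_p = ‖1 - y‖_p` for
`‖1 - y‖_p < ‖2‖_p = 1`, which holds for the principal unit `y = a^{p-1}` (Fermat)
(Iwasawa 1972, §4.4). [cite: Iwasawa1972PadicL, §4.4] -/
theorem norm_padicLog_intCast_of_not_dvd (p : ℕ) [Fact p.Prime] (hp2 : p ≠ 2) {a : ℤ}
    (ha : ¬ (p : ℤ) ∣ a) :
    ‖padicLog p (a : ℚ_[p])‖ = ‖((a ^ (p - 1) - 1 : ℤ) : ℚ_[p])‖ := by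
  have hp : p.Prime := Fact.out
  -- `‖a‖_p = 1`, `a ≠ 0` in `ℚ_p`, `ord_p a = 0`
  have ha1 : ‖(a : ℚ_[p])‖ = 1 := by
    have h : ¬ ‖(a : ℚ_[p])‖ < 1 := fun h ↦ ha (Padic.norm_intCast_lt_one_iff.mp h)
    exact le_antisymm (Padic.norm_int_le_one a) (not_lt.mp h)
  have ha0 : (a : ℚ_[p]) ≠ 0 := norm_pos_iff.mp (by rw [ha1]; exact one_pos)
  have hv : (a : ℚ_[p]).valuation = 0 := valuation_eq_of_norm_eq ha0 (n := 0) (by simpa using ha1)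
  -- `‖p - 1‖_p = 1`
  have hp1 : ‖(p : ℚ_[p]) - 1‖ = 1 := by
    have h := Padic.norm_natCast_p_sub_one (p := p)
    rwa [Nat.cast_sub hp.one_le, Nat.cast_one] at h
  -- `‖2‖_p = 1` since `p ≠ 2`
  have h2 : ‖(2 : ℚ_[p])‖ = 1 := by
    rw [show (2 : ℚ_[p]) = ((2 : ℕ) : ℚ_[p]) by norm_num, Padic.norm_natCast_eq_one_iff]
    exact (Nat.coprime_primes hp Nat.prime_two).mpr hp2
  -- `a^{p-1}` is a principal unit, inside the isometry domain
  have hy : ‖1 - (a : ℚ_[p]) ^ (p - 1)‖ < ‖(2 : ℚ_[p])‖ := by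
    rw [h2]
    exact norm_one_sub_pow_sub_one_lt ha1
  rw [padicLog_of_ne_zero ha0, hv, neg_zero, zpow_zero, mul_one, norm_mul, norm_inv, hp1,
    inv_one, one_mul, norm_padicLogSeries_eq hy, norm_sub_rev]
  push_cast
  rfl

/-- **Stub V `stub_jetVisible_of_not_heightWieferich` of line `wieferich-jet` (crux
`PAdicOrderThesisR2`, stmt-0487): not height-Wieferich ⇒ jet visible.** For an odd prime `p` and
`x ∈ ℚ` with `p ∤ num x`: if neither `(num x)^{p-1} = 1` nor
`v_p(den x) ≤ v_p((num x)^{p-1} - 1)`, then `p^{-v_p(den x)} < ‖log_p (num x)‖_p`. By the isometry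
`‖log_p a‖_p = ‖a^{p-1} - 1‖_p = p^{-v_p(a^{p-1} - 1)}` (`norm_padicLog_intCast_of_not_dvd`, the
integer `a^{p-1} - 1` being non-zero) and strict monotonicity of `n ↦ p^n`
(Iwasawa 1972, §4.4). [cite: Iwasawa1972PadicL, §4.4] -/
theorem stub_jetVisible_of_not_heightWieferich :
    ∀ (p : ℕ) [Fact p.Prime], p ≠ 2 → ∀ (x : ℚ), ¬ (p : ℤ) ∣ x.num →
      ¬ (x.num ^ (p - 1) = 1 ∨ (padicValNat p x.den : ℤ) ≤ padicValInt p (x.num ^ (p - 1) - 1)) →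
        (p : ℝ) ^ (-(padicValNat p x.den : ℤ)) < ‖padicLog p ((x.num : ℚ) : ℚ_[p])‖ := by
  intro p _ hp2 x hnd hnw
  have hp : p.Prime := Fact.out
  obtain ⟨hne1, hle⟩ := not_or.mp hnw
  have hlt : padicValInt p (x.num ^ (p - 1) - 1) < (padicValNat p x.den : ℤ) := not_le.mp hle
  have hb0 : x.num ^ (p - 1) - 1 ≠ 0 := sub_ne_zero.mpr hne1
  have hb0' : ((x.num ^ (p - 1) - 1 : ℤ) : ℚ_[p]) ≠ 0 := by exact_mod_cast hb0
  rw [Rat.cast_intCast, norm_padicLog_intCast_of_not_dvd p hp2 hnd,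
    Padic.norm_eq_zpow_neg_valuation hb0', Padic.valuation_intCast]
  exact zpow_lt_zpow_right₀ (by exact_mod_cast hp.one_lt) (neg_lt_neg hlt)

end Summit.BirchSwinnertonDyer.BirchSwinnertonDyer.Cruxes.PAdicOrderThesisR2.WieferichJet
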